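import Summits.Ventures.CertifiedArithmetic.LowPrec.SRProductLawNormal
import Summits.Ventures.CertifiedArithmetic.LowPrec.FormatsP3109
import HarnessLib

/-!
# The P3109 formats under the P3109 stochastic modes: exact random-bit thresholds for `binary8pP`

HONEST FRAMING: certified error envelopes and provably optimal rounding/accumulation schemes for
low-precision formats under stated cost models; every table by two implementations; no hardware or
vendor claims.

File LXXXVI of the SR slice.  The limited-randomness model of files LXX–LXXXV is the IEEE P3109
interim report's (`StochasticA/B/C` with `N` random bits, typed verbatim in
`Literature/ComputerArithmetic/P3109/StochasticModes`); the same report defines the 8-bit formats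
`binary8pP` (file `FormatsP3109`: `Format.Binary8p3/8p4/8p5` in the Extended domain,
`Binary8p3F/8p4F` in the Finite domain, and the FNUZ pair equal to the latter as value sets).  This
file puts the two halves of the report together: the EXACT random-bit thresholds of the three modes
on the five P3109 value sets, as instances of the structural theorems (grid theorem LXXIX/LXXX, the
lower bounds LXXXII, the product law LXXXI/LXXXIV/LXXXV):

* `Thresholds φ L J P I₁ I₂` — the packaged statement: trees of format data are exact in law for
  all three modes from `N ≥ L` bits and the pair `(−maxRat, quantum)` needs exactly `L`; every exact
  product of two values rounds with a `P`-bit dyadic up-probability and `quantum²` needs exactly `J`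
  bits; one-stage inner products are exact from `I₁ = L + J` bits and `(−maxRat, quantum²)` needs
  exactly `I₁`; two-stage inner products (products SR-rounded into the format first) are exact from
  `I₂ = max L P` bits;
* `valueSet_thresholds_exact` — every format with `emaxCode ≥ 2`, `topMan ≥ 1`, `bias + m ≥ 3` satisfies
  `Thresholds φ (emaxCode−1) (bias+m−1) (max (m+1) (bias+m−1)) (emaxCode−1+bias+m−1) (max …)`;
* instances **`binary8p3_thresholds : Thresholds Binary8p3 30 17 17 47 30`**,
  **`binary8p4_thresholds : … 14 10 10 24 14`**, **`binary8p5_thresholds : … 6 7 7 13 7`**, the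
  Finite-domain `binary8p3F/8p4F_thresholds` (same numbers; FNUZ E5M2 / E4M3 by `FnuzE5M2_eq`,
  `FnuzE4M3_eq`), and the normal term of the product law `binary8p_prod_normal` (`m + 1 = 3, 4, 5`
  bits attained by `7·7`, `15·15`, `31·31` significand products).

Remark (`binary8p5`).  `I₂ = 7 > L = 6`: precision 5 with only 3 exponent bits makes the PRODUCT
rounding (`J = 7` bits, attained by `quantum²`), not the accumulation, the binding threshold of a
two-stage inner product — the one P3109/OCP 8-bit format where this happens (OCP E4M3/E5M2 and
`binary8p3/8p4` have `I₂ = L`).  The numbers `30/17/47/30`, `14/10/24/14`, `6/7/13/7` are the rows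
`P3109_8p3/8p4/8p5` of the two-implementation certificate `certs/sr/gen15/budgets` (PAIRS, PROD,
IP1, IP2), now theorems in both directions.
-/

namespace Summit.Ventures.CertifiedArithmetic.LowPrec.SR.LimitedBits

open Literature.ComputerArithmetic.P3109
open Literature.ComputerArithmetic.ConnollyHighamMary2021
open Literature.ComputerArithmetic.FloatingPoint (Format MiniFloat)
open Literature.ComputerArithmetic.FloatingPoint.MiniFloat (valueSet valueSet_nonempty)
open Summit.Ventures.CertifiedArithmetic.LowPrec.SR
open Finset STree

/-- **The exact random-bit thresholds of a format**, packaged.  `Thresholds φ L J P I₁ I₂`: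
(TREE) every summation tree with leaves in `valueSet φ`, every node rounded by rule `A`/`B`/`C` with
`N ≥ L` bits, has the exact-SR law (all expectations `E f(ŝ)` agree), and the pair
`−maxRat + quantum` has up-probability `2^−L`, not an `(L−1)`-bit dyadic, and `probAwayA (L−1)`
vanishes there (a NEGATIVE state: one bit short rule `A` rounds up with probability `2·2^−L`, rules
`B`, `C` never — every `(L−1)`-bit rule is biased; erratum E1, files LXXXVIII/LXXXIX); (PROD) every
exact product of two values has a `P`-bit dyadic up-probability, and `quantum·quantum` has `2^−J`,
not a `(J−1)`-bit dyadic, rule `A` dead (a positive state); (IP1) one-stage inner products (exact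
products accumulated) are exact from `I₁` bits and `−maxRat + quantum²` has `2^−I₁`, not
`(I₁−1)`-bit (every `(I₁−1)`-bit rule biased);
(IP2) two-stage inner products (products SR-rounded into `valueSet φ`, then accumulated) are exact
from `I₂` bits for all three rules. -/
def Thresholds (φ : Format) (L J P I₁ I₂ : ℕ) : Prop :=
  (∀ {N : ℕ}, L ≤ N → ∀ T : STree ℚ, LeavesIn (valueSet φ) T → ∀ f : ℚ → ℚ,
    treeExpQ (valueSet φ) (probAwayA N) T f = treeExp (valueSet φ) T f ∧
    treeExpQ (valueSet φ) (probAwayB N) T f = treeExp (valueSet φ) T f ∧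
    treeExpQ (valueSet φ) (probAwayC N) T f = treeExp (valueSet φ) T f) ∧
  (pUp (valueSet φ) (-φ.maxRat + φ.quantum) = 1 / 2 ^ L ∧
    ¬ Dyadic (L - 1) (pUp (valueSet φ) (-φ.maxRat + φ.quantum)) ∧
    probAwayA (L - 1) (pUp (valueSet φ) (-φ.maxRat + φ.quantum)) = 0) ∧
  (∀ a ∈ valueSet φ, ∀ b ∈ valueSet φ, Dyadic P (pUp (valueSet φ) (a * b))) ∧
  (pUp (valueSet φ) (φ.quantum * φ.quantum) = 1 / 2 ^ J ∧
    ¬ Dyadic (J - 1) (pUp (valueSet φ) (φ.quantum * φ.quantum)) ∧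
    probAwayA (J - 1) (pUp (valueSet φ) (φ.quantum * φ.quantum)) = 0) ∧
  (∀ {N : ℕ}, I₁ ≤ N → ∀ {x y : ℕ → ℚ}, (∀ k, x k ∈ valueSet φ) → (∀ k, y k ∈ valueSet φ) →
    ∀ {s : ℚ}, s ∈ valueSet φ → ∀ (n : ℕ) (f : ℚ → ℚ),
    accExpQ (valueSet φ) (probAwayA N) (fun k => x k * y k) n f s
        = accExp (valueSet φ) (fun k => x k * y k) n f s ∧
    accExpQ (valueSet φ) (probAwayB N) (fun k => x k * y k) n f s
        = accExp (valueSet φ) (fun k => x k * y k) n f s ∧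
    accExpQ (valueSet φ) (probAwayC N) (fun k => x k * y k) n f s
        = accExp (valueSet φ) (fun k => x k * y k) n f s) ∧
  (pUp (valueSet φ) (-φ.maxRat + φ.quantum * φ.quantum) = 1 / 2 ^ I₁ ∧
    ¬ Dyadic (I₁ - 1) (pUp (valueSet φ) (-φ.maxRat + φ.quantum * φ.quantum)) ∧
    probAwayA (I₁ - 1) (pUp (valueSet φ) (-φ.maxRat + φ.quantum * φ.quantum)) = 0) ∧
  (∀ {N : ℕ}, I₂ ≤ N → ∀ {x y : ℕ → ℚ}, (∀ k, x k ∈ valueSet φ) → (∀ k, y k ∈ valueSet φ) →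
    ∀ {s : ℚ}, s ∈ valueSet φ → ∀ (n : ℕ) (f : ℚ → ℚ),
    ipExpQ (valueSet φ) (probAwayA N) (fun k => x k * y k) n f s
        = ipExp (valueSet φ) (fun k => x k * y k) n f s ∧
    ipExpQ (valueSet φ) (probAwayB N) (fun k => x k * y k) n f s
        = ipExp (valueSet φ) (fun k => x k * y k) n f s ∧
    ipExpQ (valueSet φ) (probAwayC N) (fun k => x k * y k) n f s
        = ipExp (valueSet φ) (fun k => x k * y k) n f s)

/-- **Every format has the closed-form thresholds, both directions** (`emaxCode ≥ 2`, `topMan ≥ 1`,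
`bias + m ≥ 3`): `L = emaxCode − 1`, `J = bias + m − 1`, `P = max (m+1) J`, `I₁ = L + J`,
`I₂ = max L P` — the parameters are passed as numerals with their defining equations so that the
instances below read as plain numbers. -/
theorem valueSet_thresholds_exact (φ : Format) (L J P I₁ I₂ : ℕ) (hL : φ.emaxCode - 1 = L)
    (hJ : φ.bias + φ.manBits - 1 = J) (hP : max (φ.manBits + 1) J = P) (hI₁ : L + J = I₁)
    (hI₂ : max L P = I₂) (hE : 2 ≤ φ.emaxCode) (ht : 1 ≤ φ.topMan) (h3 : 3 ≤ φ.bias + φ.manBits) :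
    Thresholds φ L J P I₁ I₂ := by
  have h1 : 1 ≤ φ.bias + φ.manBits := by omega
  have hms : 1 ≤ φ.maxScaled := by
    have : 0 < (2 ^ φ.manBits + φ.topMan) * 2 ^ (φ.emaxCode - 1) := by positivity
    rw [Format.maxScaled_eq (by omega)]; omega
  obtain ⟨-, hv, hnd, -, hA⟩ := valueSet_tree_budget_sharp φ hE ht
  obtain ⟨-, hv', hnd', -, hA'⟩ := valueSet_ip_budget_sharp φ hE ht h1
  obtain ⟨-, hw, hndw, -, hAw⟩ := valueSet_prod_law_sharp φ hms h3
  have eL : φ.emaxCode - 2 = L - 1 := by omega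
  have eJ : φ.bias + φ.manBits - 2 = J - 1 := by omega
  have eI : φ.emaxCode - 2 + (φ.bias + φ.manBits - 1) = I₁ - 1 := by omega
  have eI' : φ.emaxCode - 1 + (φ.bias + φ.manBits - 1) = I₁ := by omega
  rw [hL] at hv; rw [eL] at hnd hA; rw [hJ] at hw; rw [eJ] at hndw hAw
  rw [eI'] at hv'; rw [eI] at hnd' hA'
  refine ⟨fun hN T hT f => valueSet_tree_exact φ (by omega) T hT f, ⟨hv, hnd, hA⟩,
    fun a ha b hb => ?_, ⟨hw, hndw, hAw⟩,
    fun hN x y hx hy s hs n f => valueSet_ip_exact φ h1 (by omega) hx hy hs n f, ⟨hv', hnd', hA'⟩,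
    fun hN x y hx hy s hs n f => valueSet_ip2_exact φ h1 ?_ hx hy hs n f⟩
  · have hd := valueSet_dyadic_pUp_mul φ h1 ha hb
    rw [hJ, hP] at hd; exact hd
  · rw [hL, hJ, hP, hI₂]; exact hN

/-! ### The five P3109 value sets -/

/-- **`binary8p3` (Extended: 2 trailing bits, bias 16, top code 31): TREE 30, PROD 17, IP1 47,
IP2 30** — all exact (row `P3109_8p3` of `certs/sr/gen15/budgets`). -/
theorem binary8p3_thresholds : Thresholds Format.Binary8p3 30 17 17 47 30 :=
  valueSet_thresholds_exact _ _ _ _ _ _ (by decide) (by decide) (by decide) (by decide) (by decide)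
    (by decide) (by decide) (by decide)

/-- **`binary8p4` (Extended: 3 trailing bits, bias 8, top code 15): TREE 14, PROD 10, IP1 24,
IP2 14** (row `P3109_8p4`). -/
theorem binary8p4_thresholds : Thresholds Format.Binary8p4 14 10 10 24 14 :=
  valueSet_thresholds_exact _ _ _ _ _ _ (by decide) (by decide) (by decide) (by decide) (by decide)
    (by decide) (by decide) (by decide)

/-- **`binary8p5` (Extended: 4 trailing bits, bias 4, top code 7): TREE 6, PROD 7, IP1 13, IP2 7**
(row `P3109_8p5`) — here the product rounding, not the accumulation, binds the two-stage threshold. -/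
theorem binary8p5_thresholds : Thresholds Format.Binary8p5 6 7 7 13 7 :=
  valueSet_thresholds_exact _ _ _ _ _ _ (by decide) (by decide) (by decide) (by decide) (by decide)
    (by decide) (by decide) (by decide)

/-- **`binary8p3`, Finite domain (= FNUZ E5M2 as a value set, `FnuzE5M2_eq`): 30, 17, 47, 30.** -/
theorem binary8p3F_thresholds : Thresholds Format.Binary8p3F 30 17 17 47 30 :=
  valueSet_thresholds_exact _ _ _ _ _ _ (by decide) (by decide) (by decide) (by decide) (by decide)
    (by decide) (by decide) (by decide)

/-- **`binary8p4`, Finite domain (= FNUZ E4M3 as a value set, `FnuzE4M3_eq`): 14, 10, 24, 14.** -/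
theorem binary8p4F_thresholds : Thresholds Format.Binary8p4F 14 10 10 24 14 :=
  valueSet_thresholds_exact _ _ _ _ _ _ (by decide) (by decide) (by decide) (by decide) (by decide)
    (by decide) (by decide) (by decide)

/-- The FNUZ FP8 pair inherits the Finite-domain thresholds verbatim. -/
theorem fnuz_thresholds :
    Thresholds Format.FnuzE5M2 30 17 17 47 30 ∧ Thresholds Format.FnuzE4M3 14 10 10 24 14 :=
  ⟨Format.FnuzE5M2_eq ▸ binary8p3F_thresholds, Format.FnuzE4M3_eq ▸ binary8p4F_thresholds⟩

/-- For comparison, the OCP FP8 pair in the same package: **E4M3: 14, 9, 23, 14; E5M2: 29, 16, 45,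
29** (rows `E4M3`, `E5M2` of the certificate; cf. `fp8_budgets_exact`, `prod_law_exact_formats`). -/
theorem ocp_fp8_thresholds :
    Thresholds Format.E4M3 14 9 9 23 14 ∧ Thresholds Format.E5M2 29 16 16 45 29 :=
  ⟨valueSet_thresholds_exact _ _ _ _ _ _ (by decide) (by decide) (by decide) (by decide) (by decide)
      (by decide) (by decide) (by decide),
    valueSet_thresholds_exact _ _ _ _ _ _ (by decide) (by decide) (by decide) (by decide) (by decide)
      (by decide) (by decide) (by decide)⟩

/-- **The normal term of the product law on the P3109 value sets**: some exact product of two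
values needs exactly `m + 1` bits — `binary8p3` `3` (`7·2⁷q · 7·2⁷q`), `binary8p4` `4`
(`15·2³q · 15·2³q`), `binary8p5` `5` (`31·2q · 31·2q`); below `J`, so `P = J` in all three. -/
theorem binary8p_prod_normal :
    (∃ a ∈ valueSet Format.Binary8p3, ∃ b ∈ valueSet Format.Binary8p3,
      ¬ Dyadic 2 (pUp (valueSet Format.Binary8p3) (a * b)) ∧
        Dyadic 3 (pUp (valueSet Format.Binary8p3) (a * b))) ∧
    (∃ a ∈ valueSet Format.Binary8p4, ∃ b ∈ valueSet Format.Binary8p4,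
      ¬ Dyadic 3 (pUp (valueSet Format.Binary8p4) (a * b)) ∧
        Dyadic 4 (pUp (valueSet Format.Binary8p4) (a * b))) ∧
    (∃ a ∈ valueSet Format.Binary8p5, ∃ b ∈ valueSet Format.Binary8p5,
      ¬ Dyadic 4 (pUp (valueSet Format.Binary8p5) (a * b)) ∧
        Dyadic 5 (pUp (valueSet Format.Binary8p5) (a * b))) := by
  refine ⟨?_, ?_, ?_⟩
  · exact prod_law_normal_attained _ _ _ (by decide) (by decide) (by decide) (by decide) (by decide)
      (s := 0) (e₁ := 7) (e₂ := 7) (by decide) (by decide) (by decide) (by decide) (by decide)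
  · exact prod_law_normal_attained _ _ _ (by decide) (by decide) (by decide) (by decide) (by decide)
      (s := 0) (e₁ := 3) (e₂ := 3) (by decide) (by decide) (by decide) (by decide) (by decide)
  · exact prod_law_normal_attained _ _ _ (by decide) (by decide) (by decide) (by decide) (by decide)
      (s := 0) (e₁ := 1) (e₂ := 1) (by decide) (by decide) (by decide) (by decide) (by decide)

/-- The threshold arithmetic of the five P3109 value sets and the OCP pair, kernel-checked from the
`Format` records: `(L, J, P, I₁, I₂)`. -/
theorem p3109_threshold_values :
    (Format.Binary8p3.emaxCode - 1 = 30 ∧ Format.Binary8p3.bias + Format.Binary8p3.manBits - 1 = 17 ∧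
      max (Format.Binary8p3.manBits + 1) 17 = 17 ∧ 30 + 17 = 47 ∧ max 30 17 = 30) ∧
    (Format.Binary8p4.emaxCode - 1 = 14 ∧ Format.Binary8p4.bias + Format.Binary8p4.manBits - 1 = 10 ∧
      max (Format.Binary8p4.manBits + 1) 10 = 10 ∧ 14 + 10 = 24 ∧ max 14 10 = 14) ∧
    (Format.Binary8p5.emaxCode - 1 = 6 ∧ Format.Binary8p5.bias + Format.Binary8p5.manBits - 1 = 7 ∧
      max (Format.Binary8p5.manBits + 1) 7 = 7 ∧ 6 + 7 = 13 ∧ max 6 7 = 7) := by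
  decide

end Summit.Ventures.CertifiedArithmetic.LowPrec.SR.LimitedBits
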